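import Mathlib
import Summits.RiemannHypothesis.RiemannHypothesis.Theses.RuelleBand
import Literature.NumberTheory.LFunctions.WeilExplicit
import Literature.NumberTheory.LFunctions.ZetaZeros
import Literature.Analysis.OperatorTheory.HalfLinePositiveDefinite

/-!
# Crux ExactFirstBand (stmt-RiemannHypothesis-2061) — ideator 3, round 1: first lemmas (typed, not proved)

Two crux idea cards:
* `casimir-heat-trace`   — X ⟺ the Casimir heat trace `Z(u) = Σ_ρ m(ρ) e^{-u ρ(1-ρ)}` is positive
  definite on the semigroup `((0,∞),+)` (Bernstein–Widder "exponential convexity" = reflection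
  positivity), i.e. Weil positivity on the heat sub-cone; temperature rigidity; Hausdorff linear form;
  vertical boundedness form.
* `joukowski-hecke-reality` — X ⟺ reality of the spectrum of the two "Hecke operators"
  `T_{log 2} + T_{log 2}⁻¹`, `T_{log 3} + T_{log 3}⁻¹` of a realising group (Joukowski: spec(T+T⁻¹) ⊂ ℝ
  ⟺ spec T ⊂ S¹ ∪ ℝ), an engine that needs NO inner product.
Everything below only has to ELABORATE (`lean check` rc 0, no sorry): these are `Prop`s.
-/

noncomputable section

open Complex
open Summit.RiemannHypothesis.RiemannHypothesis.Theses.RuelleBand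
open Literature.NumberTheory.LFunctions

namespace Summit.RiemannHypothesis.RiemannHypothesis.Cruxes.ExactFirstBand.Ideator3

/-! ## Card 1: casimir-heat-trace -/

/-- Zeros of `ζ` in the open critical strip, as a subtype. -/
def StripZero : Type := {s : ℂ // riemannZeta s = 0 ∧ 0 < s.re ∧ s.re < 1}

/-- The Casimir heat trace at complex "temperature" `u`: `Z(u) = Σ_ρ m(ρ) e^{-u ρ(1-ρ)}`
(`m(ρ)` = multiplicity, the tree's hypothesis-free `riemannZetaZeroOrder`). For real `u > 0` it is the
Gaussian explicit-formula sum `e^{-u/4} Σ_ρ m(ρ) ĝ_u(ρ)`, `ĝ_u(s) = e^{u(s-1/2)²}`. -/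
def heatTraceC (u : ℂ) : ℂ :=
  ∑' ρ : StripZero, (riemannZetaZeroOrder ρ.1 : ℂ) * cexp (-u * (ρ.1 * (1 - ρ.1)))

/-- Real-temperature heat trace (real-valued by conjugation symmetry of the zeros). -/
def heatTrace (u : ℝ) : ℝ := (heatTraceC u).re

/-- Positive definiteness on the open additive semigroup `((0,∞),+)` — the tree's spelling
(`Literature.Analysis.SpecialFunctions.SemigroupPosDef`, `IsBoundedHalfLinePD.posDef`):
Bernstein–Widder "exponential convexity" = Osterwalder–Schrader reflection positivity in one variable. -/
def IsHalfLinePD (f : ℝ → ℝ) : Prop :=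
  ∀ (m : ℕ) (s c : Fin m → ℝ), (∀ a, 0 < s a) → 0 ≤ ∑ a, ∑ b, c a * c b * f (s a + s b)

/-- The same with all points in a bounded temperature window `(0, U)`. -/
def IsHalfLinePDOn (U : ℝ) (f : ℝ → ℝ) : Prop :=
  ∀ (m : ℕ) (s c : Fin m → ℝ), (∀ a, 0 < s a ∧ s a < U) → 0 ≤ ∑ a, ∑ b, c a * c b * f (s a + s b)

/-- FIRST LEMMA (M). Heat-cone positivity is exactly the crux: `Z` is positive definite on `((0,∞),+)`
iff every `ρ(1-ρ)` is real, i.e. iff `ExactFirstBand` (⟸ termwise; ⟹ Bernstein–Widder–BCR Laplace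
representation — in tree: `IsBoundedHalfLinePD.exists_laplace_repr` — plus a Hamburger/generic-lattice
pole argument). The real axis is INVISIBLE to this cone (ĝ_u(1-ρ) = ĝ_u(ρ)), so the statement is
X-shaped, not RH-shaped. -/
def HeatTraceIffExact : Prop := IsHalfLinePD heatTrace ↔ ExactFirstBand

/-- The boundedness hypothesis of the tree's Laplace-representation theorem is free for `Z`
(`|Z(u)| ≤ Σ m(ρ) e^{-u Re(ρ(1-ρ))}`, non-increasing in `u`). (S) -/
def HeatTraceBounded : Prop := ∀ t₀ : ℝ, 0 < t₀ → ∃ M : ℝ, ∀ t : ℝ, t₀ ≤ t → |heatTrace t| ≤ M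

/-- Packaging for the tree's engine. -/
def HeatTracePDPackage : Prop :=
  IsHalfLinePD heatTrace → Literature.Analysis.OperatorTheory.IsBoundedHalfLinePD heatTrace

/-- FIRST LEMMA (M). TEMPERATURE RIGIDITY: positive definiteness on ANY window `(0,U)` already gives it
on `(0,∞)` (Widder: exponential convexity on `(0,2U)` ⟹ two-sided Laplace representation converging
there; Landau–Pringsheim: a Laplace–Stieltjes transform of a monotone `α` is singular at its real
abscissa; `Z` is analytic on `Re u > 0`; hence the abscissae are `≤ 0` and `= +∞`). -/
def TemperatureRigidity : Prop :=
  ∀ U : ℝ, 0 < U → IsHalfLinePDOn U heatTrace → IsHalfLinePD heatTrace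

/-- Gaussian test function in the tree's additive normalisation (`weilMellin g s = ∫ g(t) e^{(s-1/2)t} dt`):
`g_u(t) = (4πu)^{-1/2} e^{-t²/(4u)}`, so that `ĝ_u(s) = e^{u(s-1/2)²}`. NOT compactly supported
(Schwartz), so `explicit_formula_holds` does not literally apply — the extension is the lemma below. -/
def gaussTest (u : ℝ) (t : ℝ) : ℂ := ((Real.exp (-(t ^ 2) / (4 * u)) / Real.sqrt (4 * Real.pi * u) : ℝ) : ℂ)

/-- FIRST LEMMA (M). GAUSSIAN EXPLICIT FORMULA: for `u > 0`,
`Z(u) = e^{-u/4} · W(g_u) = e^{-u/4} [ 2e^{u/4} − Σ_n Λ(n) n^{-1/2} · 2 g_u(log n)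
 + (1/2π) ∫ e^{-uτ²} Re ψ(1/4 + iτ/2) dτ − g_u(0) log π ]` (explicit formula for a Schwartz test with
Gaussian decay; every term absolutely convergent, the prime sum superexponentially). -/
def GaussianExplicitFormula : Prop :=
  ∀ u : ℝ, 0 < u → heatTraceC u = cexp (-(u : ℂ) / 4) * weilFunctional (gaussTest u)

/-- FIRST LEMMA (M). HAUSDORFF LINEAR FORM: X ⟺ for every lattice spacing `δ > 0` the sequence
`m_k = Z(kδ)` is completely monotone in the difference sense (Hausdorff moment sequence of the
push-forward of the zero measure under `λ ↦ e^{-δλ} ∈ (0,1]`). Each inequality is ONE linear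
explicit-formula statement `W(g) ≥ 0` whose POLE TERM VANISHES for `j ≥ 1`. -/
def HausdorffForm : Prop :=
  ExactFirstBand ↔ ∀ δ : ℝ, 0 < δ → ∀ j k : ℕ, 1 ≤ k →
    0 ≤ (-1 : ℝ) ^ j * (fwdDiff δ)^[j] heatTrace (k * δ)

/-- FIRST LEMMA (M). COMPLEX-TEMPERATURE FORM: X ⟺ `τ ↦ Z(σ + iτ)` is bounded on one (every) vertical
line `σ > 0` (⟹: `|Z(σ+iτ)| ≤ Z(σ)`; ⟸: an off-line `ρ` makes `|e^{-(σ+iτ)ρ(1-ρ)}| = e^{-σRe + τ Im}`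
grow exponentially in `τ`, and distinct frequencies do not cancel in mean square). On the prime side
this is TOTAL cancellation in a chirped prime sum `Σ Λ(n) n^{-1/2} (π(σ+iτ))^{-1/2} e^{-(log n)²/(4(σ+iτ))}`. -/
def VerticalBoundedness : Prop :=
  ExactFirstBand ↔ ∃ σ : ℝ, 0 < σ ∧ ∃ M : ℝ, ∀ τ : ℝ, ‖heatTraceC (σ + τ * I)‖ ≤ M

/-! ## Card 2: joukowski-hecke-reality -/

/-- ENGINE (S/M, provable, Literature-grade; NO inner product, any complex Banach space):
if `t ↦ T t` is a one-parameter group of bounded operators and the two "Hecke operators"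
`T t₁ + T (−t₁)`, `T t₂ + T (−t₂)` (`t₁/t₂` irrational) have REAL spectrum, then every joint
eigen-character `z` (`T t v = e^{tz} v`, `v ≠ 0`) satisfies `Re z = 0 ∨ Im z = 0`.
Proof: `2 cosh(t_i z) ∈ spec ⊂ ℝ`; `cosh(x+iy) ∈ ℝ ⟺ x = 0 ∨ sin y = 0`; two incommensurable `t_i`
force `y = 0` when `x ≠ 0`. This is the Joukowski map: `spec(T + T⁻¹) ⊂ ℝ ⟺ spec T ⊂ S¹ ∪ ℝ` —
exactly the X-shaped disjunction, real axis included. -/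
def JoukowskiEngine : Prop :=
  ∀ (H : Type) [NormedAddCommGroup H] [NormedSpace ℂ H] [CompleteSpace H] (T : ℝ → H →L[ℂ] H),
    T 0 = ContinuousLinearMap.id ℂ H → (∀ s t : ℝ, T (s + t) = (T s).comp (T t)) →
    ∀ t₁ t₂ : ℝ, 0 < t₁ → 0 < t₂ → Irrational (t₁ / t₂) →
    spectrum ℂ (T t₁ + T (-t₁)) ⊆ Set.range ((↑) : ℝ → ℂ) →
    spectrum ℂ (T t₂ + T (-t₂)) ⊆ Set.range ((↑) : ℝ → ℂ) →
    ∀ z : ℂ, (∃ v : H, v ≠ 0 ∧ ∀ t : ℝ, T t v = cexp (↑t * z) • v) → z.re = 0 ∨ z.im = 0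

/-- ENGINE, point-spectrum form (S/M, provable; the form a PINNED construction should target, since on weighted
completions the essential spectrum of the Hecke operators is an ellipse for soft reasons): it suffices that every
EIGENVALUE of the two Hecke operators is real. Same proof. -/
def JoukowskiEnginePoint : Prop :=
  ∀ (H : Type) [NormedAddCommGroup H] [NormedSpace ℂ H] [CompleteSpace H] (T : ℝ → H →L[ℂ] H),
    T 0 = ContinuousLinearMap.id ℂ H → (∀ s t : ℝ, T (s + t) = (T s).comp (T t)) →
    ∀ t₁ t₂ : ℝ, 0 < t₁ → 0 < t₂ → Irrational (t₁ / t₂) →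
    (∀ (μ : ℂ) (v : H), v ≠ 0 → (T t₁ + T (-t₁)) v = μ • v → μ.im = 0) →
    (∀ (μ : ℂ) (v : H), v ≠ 0 → (T t₂ + T (-t₂)) v = μ • v → μ.im = 0) →
    ∀ z : ℂ, (∃ v : H, v ≠ 0 ∧ ∀ t : ℝ, T t v = cexp (↑t * z) • v) → z.re = 0 ∨ z.im = 0

/-- TYPED SHADOW (the X-shaped analogue of the route's `BandRealisation`): a Banach-space group
realising every non-trivial zero as a joint eigenvalue `e^{t(ρ − 1/2)}` whose Hecke operators at the
primes 2 and 3 have real spectrum. -/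
def HeckeRealisation : Prop :=
  ∃ (H : Type) (_ : NormedAddCommGroup H) (_ : NormedSpace ℂ H) (_ : CompleteSpace H) (T : ℝ → H →L[ℂ] H),
    T 0 = ContinuousLinearMap.id ℂ H ∧ (∀ s t : ℝ, T (s + t) = (T s).comp (T t)) ∧
    spectrum ℂ (T (Real.log 2) + T (-Real.log 2)) ⊆ Set.range ((↑) : ℝ → ℂ) ∧
    spectrum ℂ (T (Real.log 3) + T (-Real.log 3)) ⊆ Set.range ((↑) : ℝ → ℂ) ∧
    ∀ s : ℂ, riemannZeta s = 0 → 0 < s.re → s.re < 1 →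
      ∃ v : H, v ≠ 0 ∧ ∀ t : ℝ, T t v = cexp (↑t * (s - 1 / 2)) • v

/-- (S after the engine + `Irrational (log 2 / log 3)`): the shadow implies the crux. -/
def HeckeRealisationToExact : Prop := HeckeRealisation → ExactFirstBand

/-- CALIBRATION / honesty (M): under X the diagonal group on `ℓ²` (or `c₀`) realises all zeros with
`T t + T (−t) = diag(2 cosh(t(ρ−1/2)))` real-diagonal; so the shadow is ⟺ X and carries no
arithmetic — its role is to make "reality of the Hecke operators π₋(2)+π₋(2)⁻¹, π₋(3)+π₋(3)⁻¹ on a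
completion of Meyer's H⁰₋" the Lean object a construction must discharge. -/
def ExactToHeckeRealisation : Prop := ExactFirstBand → HeckeRealisation

/-- Sanity (S): the two engines of the ladder compose — real Hecke spectrum is strictly weaker than
unitarity (`T` unitary ⟹ `T + T⁻¹ = T + T*` self-adjoint) and strictly X-shaped. Recorded as the
implication between the route's typed hypotheses at one time `t₀` (inner-product version). -/
def UnitaryImpliesRealHecke : Prop :=
  ∀ (H : Type) [NormedAddCommGroup H] [InnerProductSpace ℂ H] [CompleteSpace H] (U : H →L[ℂ] H),
    U ∈ unitary (H →L[ℂ] H) → spectrum ℂ (U + (star U)) ⊆ Set.range ((↑) : ℝ → ℂ)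

end Summit.RiemannHypothesis.RiemannHypothesis.Cruxes.ExactFirstBand.Ideator3
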